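import Literature.Geometry.Riemannian.MassDistribution
import Literature.Geometry.Riemannian.WassersteinW1Prokhorov
import Mathlib.MeasureTheory.Measure.Portmanteau
import HarnessLib

/-!
# The mass distribution function is upper semicontinuous under `W₁`-limits (Bamler 2023, §2.5,
# Lemma (b))

R. Bamler, *Compactness theory of the space of super Ricci flows*, Invent. Math. 233 (2023), §2.5,
the Lemma on `W₁`-limits, (b): *"For any `ε ∈ (0, 1]`, `r > 0`, we have
`b^{(X,d,μ_∞)}_r(ε) ≥ limsup_{i→∞} b^{(X,d,μᵢ)}_r(ε)`"* for probability measures `μᵢ → μ_∞` in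
`W₁` on a (complete) separable metric space. We prove it in the form used for the closedness of
`𝕄_r(V, b)`: if `b^{(X,d,μᵢ)}_r(ε) ≥ b` for all `i`, i.e. `μᵢ({x : μᵢ(D(x, εr)) < b}) ≤ ε`, then the
same holds for `μ_∞`. The printed proof is followed: assuming `μ_∞({μ_∞(D(x, εr)) < b}) > ε`,
continuity of measures gives `r' > εr` and `b' < b` with `μ_∞(S) > ε` for the OPEN set
`S := {x : μ_∞(D(x, r')) < b'}`; a coupling `qᵢ` of `μᵢ, μ_∞` of cost `< (r' − εr)(b − b')`
forces `S ⊆ {x : μᵢ(D(x, εr)) < b}` (*"`qᵢ(D(x, εr) × (X ∖ D(x, r'))) ≥ μᵢ(D(x, εr)) −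
μ_∞(D(x, r')) > b − b'`"* while `d > r' − εr` there); and the portmanteau inequality
`liminf μᵢ(S) ≥ μ_∞(S)` yields the contradiction `ε ≥ liminf μᵢ(S) ≥ μ_∞(S) > ε`.

* `tendsto_measure_closedBall_nhdsGT` — `μ(D(x, r')) → μ(D(x, ρ))` as `r' ↓ ρ`;
* `isOpen_thinSet` — `{x : μ(D(x, ρ)) < δ}` is open (upper semicontinuity of `x ↦ μ(D(x, ρ))`);
* `measure_prod_compl_ge`, `thinSet_subset_thinSet_of_isCoupling` — the coupling argument;
* `measure_thinSet_le_of_tendsto_wassersteinW1` — **(b)**; `le_massDistribution_of_tendsto` —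
  the same in terms of `b^{(X,d,μ)}_r`.

Everything is proved; no definitions, no named facts.

## References

* R. H. Bamler, *Compactness theory of the space of super Ricci flows*, Invent. Math. 233 (2023),
  §2.5, Lemma (W₁-limits), (b), proof. [Bamler2023]
-/

noncomputable section

open Set MeasureTheory Filter Topology Metric
open scoped ENNReal NNReal

namespace Literature.Geometry.Riemannian

variable {X : Type*} [MetricSpace X] [MeasurableSpace X] [BorelSpace X]

/-! ### Continuity of `r ↦ μ(D(x, r))` from the right and openness of the thin sets -/

/-- **`μ(D(x, r')) → μ(D(x, ρ))` as `r' ↓ ρ`** for a finite measure (continuity from above: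
`⋂_{r' > ρ} D(x, r') = D(x, ρ)`). [cite: Bamler2023, §2.5, proof of the Lemma (W₁-limits), (b)] -/
theorem tendsto_measure_closedBall_nhdsGT (μ : Measure X) [IsFiniteMeasure μ] (x : X) (ρ : ℝ) :
    Tendsto (fun r' ↦ μ (closedBall x r')) (𝓝[>] ρ) (𝓝 (μ (closedBall x ρ))) := by
  have h := tendsto_measure_biInter_gt (μ := μ) (s := fun r' ↦ closedBall x r') (a := ρ)
    (fun r _ ↦ measurableSet_closedBall.nullMeasurableSet)
    (fun i j _ hij ↦ closedBall_subset_closedBall hij) ⟨ρ + 1, by linarith, measure_ne_top _ _⟩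
  have heq : (⋂ r > ρ, closedBall x r) = closedBall x ρ := by
    ext y
    simp only [mem_iInter, mem_closedBall]
    constructor
    · intro hy
      by_contra hlt
      rw [not_le] at hlt
      have := hy ((dist y x + ρ) / 2) (by linarith)
      linarith
    · intro hy r hr
      linarith
  rw [heq] at h
  exact h

/-- **The thin sets are open**: `x ↦ μ(D(x, ρ))` is upper semicontinuous — for `d(x, x₀) < δ`,
`D(x, ρ) ⊆ D(x₀, ρ + δ)` and `μ(D(x₀, ρ + δ)) → μ(D(x₀, ρ))` (Bamler 2023, §2.5, proof of the Lemma
(b): *"note that `S := {x ∈ X : μ_∞(D(x, r')) < b'}` is open"*).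
[cite: Bamler2023, §2.5, proof of the Lemma (W₁-limits), (b)] -/
theorem isOpen_thinSet (μ : Measure X) [IsFiniteMeasure μ] (ρ : ℝ) (δ : ℝ≥0∞) :
    IsOpen (thinSet μ ρ δ) := by
  rw [Metric.isOpen_iff]
  intro x₀ hx₀
  rw [mem_thinSet] at hx₀
  -- `μ(D(x₀, ρ + η)) < δ` for small `η > 0`
  have hev : ∀ᶠ r' in 𝓝[>] ρ, μ (closedBall x₀ r') < δ :=
    (tendsto_order.1 (tendsto_measure_closedBall_nhdsGT μ x₀ ρ)).2 δ hx₀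
  obtain ⟨r', hlt, hr'⟩ := (hev.and self_mem_nhdsWithin).exists
  refine ⟨r' - ρ, by simpa using hr', fun x hx ↦ ?_⟩
  rw [mem_thinSet]
  refine lt_of_le_of_lt (measure_mono fun y hy ↦ ?_) hlt
  rw [mem_closedBall] at hy ⊢
  rw [mem_ball] at hx
  linarith [dist_triangle y x x₀]

/-! ### The coupling argument -/

omit [MetricSpace X] [BorelSpace X] in
/-- For a coupling `q` of `μ₁, μ₂`: `q(A × Bᶜ) ≥ μ₁(A) − μ₂(B)` (here:
`q(D(x, εr) × (X ∖ D(x, r'))) ≥ μᵢ(D(x, εr)) − μ_∞(D(x, r'))`).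
[cite: Bamler2023, §2.5, proof of the Lemma (W₁-limits), (b), fourth display] -/
theorem measure_prod_compl_ge {μ₁ μ₂ : Measure X} {q : Measure (X × X)} (hq : IsCoupling μ₁ μ₂ q)
    {A B : Set X} (hA : MeasurableSet A) (hB : MeasurableSet B) :
    μ₁ A - μ₂ B ≤ q (A ×ˢ Bᶜ) := by
  obtain ⟨-, hq1, hq2⟩ := hq
  rw [tsub_le_iff_right]
  calc μ₁ A = q (A ×ˢ univ) := by rw [← hq1, Measure.fst_apply hA, prod_univ]
    _ ≤ q (A ×ˢ Bᶜ ∪ univ ×ˢ B) := measure_mono fun p hp ↦ by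
        by_cases h : p.2 ∈ B
        · exact Or.inr ⟨mem_univ _, h⟩
        · exact Or.inl ⟨hp.1, h⟩
    _ ≤ q (A ×ˢ Bᶜ) + q (univ ×ˢ B) := measure_union_le _ _
    _ = q (A ×ˢ Bᶜ) + μ₂ B := by rw [← hq2, Measure.snd_apply hB, univ_prod]

/-- **The inclusion `{μ_∞(D(x, r')) < b'} ⊆ {μᵢ(D(x, ρ)) < b}`** forced by a cheap coupling
(Bamler 2023, §2.5, proof of the Lemma (b), (2.11)): if `q` couples `μᵢ, μ_∞` with
`∫ d dq < (r' − ρ)(b − b')`, then `μ_∞(D(x, r')) < b'` implies `μᵢ(D(x, ρ)) < b` — else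
`q(D(x, ρ) × D(x, r')ᶜ) ≥ b − b'` while `d > r' − ρ` on that set.
[cite: Bamler2023, §2.5, proof of the Lemma (W₁-limits), (b), (2.11)] -/
theorem thinSet_subset_thinSet_of_isCoupling [SecondCountableTopology X] {μi μ : Measure X}
    {q : Measure (X × X)} (hq : IsCoupling μi μ q) {ρ r' : ℝ} {b b' : ℝ≥0∞}
    (hcost : ∫⁻ p, edist p.1 p.2 ∂q < ENNReal.ofReal (r' - ρ) * (b - b')) :
    thinSet μ r' b' ⊆ thinSet μi ρ b := by
  intro x hx
  rw [mem_thinSet] at hx ⊢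
  by_contra hle
  rw [not_lt] at hle
  set A : Set (X × X) := closedBall x ρ ×ˢ (closedBall x r')ᶜ with hA
  have hAm : MeasurableSet A := measurableSet_closedBall.prod measurableSet_closedBall.compl
  -- mass of `A`
  have hmass : b - b' ≤ q A :=
    calc b - b' ≤ μi (closedBall x ρ) - μ (closedBall x r') := tsub_le_tsub hle hx.le
      _ ≤ q A := measure_prod_compl_ge hq measurableSet_closedBall measurableSet_closedBall
  -- distance on `A`
  have hdist : ∀ p ∈ A, ENNReal.ofReal (r' - ρ) ≤ edist p.1 p.2 := fun p hp ↦ by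
    rw [hA, mem_prod, mem_closedBall, mem_compl_iff, mem_closedBall, not_le] at hp
    rw [edist_dist]
    refine ENNReal.ofReal_le_ofReal ?_
    linarith [dist_triangle p.2 p.1 x, dist_comm p.1 p.2]
  have hint : ENNReal.ofReal (r' - ρ) * (b - b') ≤ ∫⁻ p, edist p.1 p.2 ∂q :=
    calc ENNReal.ofReal (r' - ρ) * (b - b') ≤ ENNReal.ofReal (r' - ρ) * q A := by gcongr
      _ = ∫⁻ _ in A, ENNReal.ofReal (r' - ρ) ∂q := (setLIntegral_const _ _).symm
      _ ≤ ∫⁻ p in A, edist p.1 p.2 ∂q := setLIntegral_mono measurable_edist hdist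
      _ ≤ ∫⁻ p, edist p.1 p.2 ∂q := setLIntegral_le_lintegral _ _
  exact absurd hcost (not_lt.2 hint)

/-! ### (b): upper semicontinuity of the mass distribution under `W₁`-limits -/

variable [SecondCountableTopology X]

/-- **(b) of the Lemma on `W₁`-limits** (Bamler 2023, §2.5): if `d_{W₁}(μᵢ, μ_∞) → 0` and
`μᵢ({x : μᵢ(D(x, ρ)) < b}) ≤ ε` for all `i`, then `μ_∞({x : μ_∞(D(x, ρ)) < b}) ≤ ε`.
[cite: Bamler2023, §2.5, Lemma (W₁-limits), (b)] -/
theorem measure_thinSet_le_of_tendsto_wassersteinW1 {μs : ℕ → ProbabilityMeasure X}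
    {μ : ProbabilityMeasure X}
    (h : Tendsto (fun i ↦ wassersteinW1 (μs i : Measure X) (μ : Measure X)) atTop (𝓝 0))
    {ρ : ℝ} {b ε : ℝ≥0∞} (hthin : ∀ i, (μs i : Measure X) (thinSet (μs i : Measure X) ρ b) ≤ ε) :
    (μ : Measure X) (thinSet (μ : Measure X) ρ b) ≤ ε := by
  by_contra hgt
  rw [not_le] at hgt
  -- `b > 0`
  have hb0 : b ≠ 0 := by
    rintro rfl
    rw [thinSet_zero, measure_empty] at hgt
    exact not_lt_bot hgt
  -- Step 1: some `r' > ρ` with `μ(thinSet μ r' b) > ε`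
  obtain ⟨r', hρr', hr'⟩ : ∃ r' > ρ, ε < (μ : Measure X) (thinSet (μ : Measure X) r' b) := by
    set T : ℕ → Set X := fun n ↦ thinSet (μ : Measure X) (ρ + 1 / ((n : ℝ) + 1)) b with hT
    have hmono : Monotone T := fun m n hmn ↦ thinSet_anti _ (by
      have : (1 : ℝ) / ((n : ℝ) + 1) ≤ 1 / ((m : ℝ) + 1) :=
        one_div_le_one_div_of_le (by positivity)
          (by exact_mod_cast (Nat.succ_le_succ hmn : m + 1 ≤ n + 1))
      linarith) _
    have hsub : thinSet (μ : Measure X) ρ b ⊆ ⋃ n, T n := by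
      intro x hx
      rw [mem_thinSet] at hx
      have hev : ∀ᶠ r' in 𝓝[>] ρ, (μ : Measure X) (closedBall x r') < b :=
        (tendsto_order.1 (tendsto_measure_closedBall_nhdsGT (μ : Measure X) x ρ)).2 b hx
      -- the sequence `ρ + 1/(n+1)` tends to `ρ` from the right
      have hseq : Tendsto (fun n : ℕ ↦ ρ + 1 / ((n : ℝ) + 1)) atTop (𝓝[>] ρ) := by
        refine tendsto_nhdsWithin_iff.2 ⟨?_, Eventually.of_forall fun n ↦ ?_⟩
        · have h1 := (tendsto_const_nhds (x := ρ) (f := (atTop : Filter ℕ))).add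
            (tendsto_one_div_add_atTop_nhds_zero_nat (𝕜 := ℝ))
          rwa [add_zero] at h1
        · simp only [mem_Ioi, lt_add_iff_pos_right]
          positivity
      obtain ⟨n, hn⟩ := (hseq.eventually hev).exists
      exact mem_iUnion.2 ⟨n, hn⟩
    have hlt : ε < (μ : Measure X) (⋃ n, T n) := hgt.trans_le (measure_mono hsub)
    rw [hmono.measure_iUnion] at hlt
    obtain ⟨n, hn⟩ := lt_iSup_iff.1 hlt
    exact ⟨ρ + 1 / ((n : ℝ) + 1), by simp only [gt_iff_lt, lt_add_iff_pos_right]; positivity, hn⟩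
  -- Step 2: some `b' < b` with `μ(thinSet μ r' b') > ε`
  obtain ⟨b', hb'b, hb'⟩ : ∃ b' < b, ε < (μ : Measure X) (thinSet (μ : Measure X) r' b') := by
    obtain ⟨u, hu_mono, hu_mem, hu_lim⟩ := exists_seq_strictMono_tendsto' (pos_iff_ne_zero.2 hb0)
    have hunion : thinSet (μ : Measure X) r' b ⊆ ⋃ n, thinSet (μ : Measure X) r' (u n) := by
      intro x hx
      rw [mem_thinSet] at hx
      obtain ⟨n, hn⟩ := ((tendsto_order.1 hu_lim).1 _ hx).exists
      exact mem_iUnion.2 ⟨n, hn⟩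
    have hmono : Monotone fun n ↦ thinSet (μ : Measure X) r' (u n) := fun m n hmn ↦
      thinSet_mono _ _ (hu_mono.monotone hmn)
    have hlt : ε < (μ : Measure X) (⋃ n, thinSet (μ : Measure X) r' (u n)) :=
      hr'.trans_le (measure_mono hunion)
    rw [hmono.measure_iUnion] at hlt
    obtain ⟨n, hn⟩ := lt_iSup_iff.1 hlt
    exact ⟨u n, (hu_mem n).2, hn⟩
  -- Step 3: for large `i`, `S := thinSet μ r' b' ⊆ thinSet (μs i) ρ b`
  set S : Set X := thinSet (μ : Measure X) r' b' with hS
  have hpos : 0 < ENNReal.ofReal (r' - ρ) * (b - b') :=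
    ENNReal.mul_pos (ENNReal.ofReal_pos.2 (by linarith)).ne' (tsub_pos_of_lt hb'b).ne'
  have hevS : ∀ᶠ i in atTop, S ⊆ thinSet (μs i : Measure X) ρ b := by
    filter_upwards [(tendsto_order.1 h).2 _ hpos] with i hi
    obtain ⟨⟨q, hq⟩, hcost⟩ := iInf_lt_iff.1 hi
    exact thinSet_subset_thinSet_of_isCoupling hq hcost
  -- Step 4: `S` is open, portmanteau
  have hSopen : IsOpen S := isOpen_thinSet _ _ _
  have hweak : Tendsto μs atTop (𝓝 μ) := ProbabilityMeasure.tendsto_of_tendsto_wassersteinW1 h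
  have hport : (μ : Measure X) S ≤ liminf (fun i ↦ (μs i : Measure X) S) atTop :=
    ProbabilityMeasure.le_liminf_measure_open_of_tendsto hweak hSopen
  have hlim : liminf (fun i ↦ (μs i : Measure X) S) atTop ≤ ε := by
    refine liminf_le_of_frequently_le' (Eventually.frequently ?_)
    filter_upwards [hevS] with i hi
    exact (measure_mono hi).trans (hthin i)
  exact absurd (hb'.trans_le (hport.trans hlim)) (lt_irrefl _)

/-- **(b) in terms of the mass distribution function**: if `d_{W₁}(μᵢ, μ_∞) → 0` and
`b^{(X,d,μᵢ)}_r(ε) ≥ β` for all `i` (`β ≤ 1`), then `b^{(X,d,μ_∞)}_r(ε) ≥ β` — i.e.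
`b^{(X,d,μ_∞)}_r(ε) ≥ limsup b^{(X,d,μᵢ)}_r(ε)` tested against constants.
[cite: Bamler2023, §2.5, Lemma (W₁-limits), (b)] -/
theorem le_massDistribution_of_tendsto {μs : ℕ → ProbabilityMeasure X} {μ : ProbabilityMeasure X}
    (h : Tendsto (fun i ↦ wassersteinW1 (μs i : Measure X) (μ : Measure X)) atTop (𝓝 0))
    {r ε : ℝ} {β : ℝ≥0∞} (hβ : β ≤ 1)
    (hb : ∀ i, β ≤ massDistribution (μs i : Measure X) r ε) :
    β ≤ massDistribution (μ : Measure X) r ε := by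
  rw [le_massDistribution_iff _ _ _ hβ]
  exact measure_thinSet_le_of_tendsto_wassersteinW1 h fun i ↦
    (le_massDistribution_iff _ _ _ hβ).1 (hb i)

end Literature.Geometry.Riemannian

end
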